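import Summits.HodgeConjecture.CorCM.CyclicAsymmetricCMHalves
import Summits.HodgeConjecture.CorCM.AbelianTwoGroupInvolutionLemmas
import HarnessLib

/-!
# Asymmetric aperiodic CM halves of `ℤ/2n × ℤ/2` (`n ≥ 4`)

COR-CM (cell `pub-hodgecm2`), binder seat b04 (gen 22), count-neutral claim GALOIS-DIHEDRAL, part VI-a — the
combinatorial input of the mirror types of part V (`CorCM/GaloisDihedralTimesTwoMirrorTypes`, Galois groups
`D_{2n} × C₂`).  KERNEL ONLY: theorems; no definition, no named fact, no `sorry`.  `HC_CM` is neither used nor claimed.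

`A = ℤ/2n × ℤ/2`, `h = (n, 0)`.  A CM HALF is `S ⊆ A` with `p ∈ S ⟺ h + p ∉ S`; APERIODIC: `j + S ≠ S` for `j ≠ 0`;
ASYMMETRIC: `u − S ≠ S` for all `u ∈ A`.  Seat census (`scratch/g22i.py`): the numbers of aperiodic asymmetric CM halves
of `ℤ/2n × ℤ/2` for `n = 1, …, 6` are `0, 0, 0, 96, 480, 3024` — they exist iff `n ≥ 4` (for `ℤ/2n` alone: iff `n ≥ 6`,
part II).  The explicit family: row `0` the interval, row `1` the interval with the point `1` replaced by its antipode,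
`S(n) = ([0, n) × {0}) ∪ (({0} ∪ [2, n) ∪ {n + 1}) × {1})`, i.e.
`(k, z) ∈ S ⟺ (z = 0 ∧ k < n) ∨ (z = 1 ∧ ((k < n ∧ k ≠ 1) ∨ k = n + 1))` (residues `k` read in `[0, 2n)`).
For `n ≥ 4`: `exists_half₂`, `half₂_mem_iff_add_not_mem` (CM), `half₂_aperiodic`, `half₂_asymmetric` — the interval row
pins every candidate period / axis (`j₁ = 0` resp. `u₁ = n − 1` or `u₁ = 0`), and the displaced point of row `1` breaks it.

## References

* [Shimura1998] G. Shimura, *Abelian Varieties with Complex Multiplication and Modular Functions*, §8.2 Prop. 26.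
-/

namespace Summit.HodgeConjecture.CorCM.CyclicAsymmetricHalvesTimesTwo

open Summit.HodgeConjecture.CorCM.CyclicAsymmetricHalves
open Summit.HodgeConjecture.CorCM.TwoGroupPieces (zmod_two_cases)

variable {n : ℕ} [NeZero n] {S : Finset (ZMod (2 * n) × ZMod 2)}

/-- **The explicit half exists.** [folklore] -/
theorem exists_half₂ (n : ℕ) [NeZero n] : ∃ S : Finset (ZMod (2 * n) × ZMod 2), ∀ p : ZMod (2 * n) × ZMod 2,
    p ∈ S ↔ (p.2 = 0 ∧ p.1.val < n) ∨ (p.2 = 1 ∧ ((p.1.val < n ∧ p.1.val ≠ 1) ∨ p.1.val = n + 1)) :=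
  ⟨Finset.univ.filter fun p => (p.2 = 0 ∧ p.1.val < n) ∨ (p.2 = 1 ∧ ((p.1.val < n ∧ p.1.val ≠ 1) ∨ p.1.val = n + 1)),
    fun p => by simp⟩

omit [NeZero n] in
/-- Membership of `((c : ℕ), 0)`, `c < 2n`. [folklore] -/
theorem natCast_zero_mem_iff
    (hS : ∀ p : ZMod (2 * n) × ZMod 2,
      p ∈ S ↔ (p.2 = 0 ∧ p.1.val < n) ∨ (p.2 = 1 ∧ ((p.1.val < n ∧ p.1.val ≠ 1) ∨ p.1.val = n + 1)))
    {c : ℕ} (hc : c < 2 * n) : ((c : ZMod (2 * n)), (0 : ZMod 2)) ∈ S ↔ c < n := by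
  rw [hS, val_natCast_of_lt' hc]
  simp

omit [NeZero n] in
/-- Membership of `((c : ℕ), 1)`, `c < 2n`. [folklore] -/
theorem natCast_one_mem_iff
    (hS : ∀ p : ZMod (2 * n) × ZMod 2,
      p ∈ S ↔ (p.2 = 0 ∧ p.1.val < n) ∨ (p.2 = 1 ∧ ((p.1.val < n ∧ p.1.val ≠ 1) ∨ p.1.val = n + 1)))
    {c : ℕ} (hc : c < 2 * n) : ((c : ZMod (2 * n)), (1 : ZMod 2)) ∈ S ↔ (c < n ∧ c ≠ 1) ∨ c = n + 1 := by
  rw [hS, val_natCast_of_lt' hc]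
  simp

omit [NeZero n] in
/-- Membership of `(k, 0)`. [folklore] -/
theorem mk_zero_mem_iff
    (hS : ∀ p : ZMod (2 * n) × ZMod 2,
      p ∈ S ↔ (p.2 = 0 ∧ p.1.val < n) ∨ (p.2 = 1 ∧ ((p.1.val < n ∧ p.1.val ≠ 1) ∨ p.1.val = n + 1)))
    (k : ZMod (2 * n)) : (k, (0 : ZMod 2)) ∈ S ↔ k.val < n := by
  rw [hS]; simp

omit [NeZero n] in
/-- Membership of `(k, 1)`. [folklore] -/
theorem mk_one_mem_iff
    (hS : ∀ p : ZMod (2 * n) × ZMod 2,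
      p ∈ S ↔ (p.2 = 0 ∧ p.1.val < n) ∨ (p.2 = 1 ∧ ((p.1.val < n ∧ p.1.val ≠ 1) ∨ p.1.val = n + 1)))
    (k : ZMod (2 * n)) : (k, (1 : ZMod 2)) ∈ S ↔ (k.val < n ∧ k.val ≠ 1) ∨ k.val = n + 1 := by
  rw [hS]; simp

/-- **`S` is a CM half for `h = (n, 0)`**: `p ∈ S ↔ (n, 0) + p ∉ S` (`n ≥ 2`). [cite: Shimura1998, §8.2 Prop. 26] -/
theorem half₂_mem_iff_add_not_mem (h2 : 2 ≤ n)
    (hS : ∀ p : ZMod (2 * n) × ZMod 2,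
      p ∈ S ↔ (p.2 = 0 ∧ p.1.val < n) ∨ (p.2 = 1 ∧ ((p.1.val < n ∧ p.1.val ≠ 1) ∨ p.1.val = n + 1)))
    (p : ZMod (2 * n) × ZMod 2) : p ∈ S ↔ (((n : ℕ) : ZMod (2 * n)), (0 : ZMod 2)) + p ∉ S := by
  obtain ⟨k, z⟩ := p
  have hk := k.val_lt
  have hval : ((n : ZMod (2 * n)) + k).val = if k.val < n then k.val + n else k.val - n := by
    rw [add_comm, val_add_natCast_eq k (show n < 2 * n by omega)]
    split_ifs <;> omega
  rcases zmod_two_cases z with rfl | rfl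
  · rw [Prod.mk_add_mk, add_zero, mk_zero_mem_iff hS, mk_zero_mem_iff hS, hval]
    split_ifs <;> omega
  · rw [Prod.mk_add_mk, zero_add, mk_one_mem_iff hS, mk_one_mem_iff hS, hval]
    split_ifs <;> omega

/-- **`S` is APERIODIC** (`n ≥ 3`): the interval row forces `j₁ = 0` (resp. `j₁ = n − 1` when the rows are swapped),
and the displaced point of row `1` breaks it. [cite: Shimura1998, §8.2 Prop. 26] -/
theorem half₂_aperiodic (h3 : 3 ≤ n)
    (hS : ∀ p : ZMod (2 * n) × ZMod 2,
      p ∈ S ↔ (p.2 = 0 ∧ p.1.val < n) ∨ (p.2 = 1 ∧ ((p.1.val < n ∧ p.1.val ≠ 1) ∨ p.1.val = n + 1)))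
    {j : ZMod (2 * n) × ZMod 2} (hj : j ≠ 0) : ∃ k, ¬ (k ∈ S ↔ j + k ∈ S) := by
  by_contra hall
  push Not at hall
  obtain ⟨j₁, j₂⟩ := j
  have hb := j₁.val_lt
  rcases zmod_two_cases j₂ with rfl | rfl
  · -- the rows are preserved: row `0` is an interval
    have hj₁ : j₁.val ≠ 0 := fun h => hj (by rw [(ZMod.val_eq_zero j₁).1 h]; rfl)
    have hA := (hall (((0 : ℕ) : ZMod (2 * n)), 0)).1 ((natCast_zero_mem_iff hS (by omega)).2 (by omega))
    rw [Prod.mk_add_mk, add_zero, Nat.cast_zero, add_zero, mk_zero_mem_iff hS] at hA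
    have hB := (hall (((n - 1 : ℕ) : ZMod (2 * n)), 0)).1 ((natCast_zero_mem_iff hS (by omega)).2 (by omega))
    rw [Prod.mk_add_mk, add_zero, mk_zero_mem_iff hS, val_add_natCast_eq j₁ (show n - 1 < 2 * n by omega)] at hB
    split_ifs at hB <;> omega
  · -- the rows are swapped
    have hA := (hall (((0 : ℕ) : ZMod (2 * n)), 1)).1
      ((natCast_one_mem_iff hS (by omega)).2 (Or.inl ⟨by omega, by omega⟩))
    rw [Prod.mk_add_mk, Nat.cast_zero, add_zero, show (1 : ZMod 2) + 1 = 0 by decide, mk_zero_mem_iff hS] at hA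
    have hB : ¬ ((j₁ + ((1 : ℕ) : ZMod (2 * n)), (1 : ZMod 2) + 1) ∈ S) := fun h =>
      absurd ((hall (((1 : ℕ) : ZMod (2 * n)), 1)).2 (by rwa [Prod.mk_add_mk]))
        (by rw [natCast_one_mem_iff hS (by omega)]; omega)
    rw [show (1 : ZMod 2) + 1 = 0 by decide, mk_zero_mem_iff hS,
      val_add_natCast_eq j₁ (show 1 < 2 * n by omega)] at hB
    have hC := (hall (((2 : ℕ) : ZMod (2 * n)), 1)).1
      ((natCast_one_mem_iff hS (by omega)).2 (Or.inl ⟨by omega, by omega⟩))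
    rw [Prod.mk_add_mk, show (1 : ZMod 2) + 1 = 0 by decide, mk_zero_mem_iff hS,
      val_add_natCast_eq j₁ (show 2 < 2 * n by omega)] at hC
    split_ifs at hB hC <;> omega

/-- **`S` is ASYMMETRIC** (`n ≥ 4`): an axis `(u₁, 0)` must be `u₁ = n − 1` (row `0`), contradicted by the point
`(n + 1, 1)`; an axis `(u₁, 1)` must be `u₁ = 0`, contradicted by `(2, 1)`. [cite: Shimura1998, §8.2 Prop. 26] -/
theorem half₂_asymmetric (h4 : 4 ≤ n)
    (hS : ∀ p : ZMod (2 * n) × ZMod 2,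
      p ∈ S ↔ (p.2 = 0 ∧ p.1.val < n) ∨ (p.2 = 1 ∧ ((p.1.val < n ∧ p.1.val ≠ 1) ∨ p.1.val = n + 1)))
    (u : ZMod (2 * n) × ZMod 2) : ∃ k, ¬ (k ∈ S ↔ u - k ∈ S) := by
  by_contra hall
  push Not at hall
  obtain ⟨u₁, u₂⟩ := u
  have ha := u₁.val_lt
  rcases zmod_two_cases u₂ with rfl | rfl
  · -- axis `(u₁, 0)`: the rows are preserved
    have hA := (hall (((0 : ℕ) : ZMod (2 * n)), 0)).1 ((natCast_zero_mem_iff hS (by omega)).2 (by omega))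
    rw [Prod.mk_sub_mk, sub_zero, Nat.cast_zero, sub_zero, mk_zero_mem_iff hS] at hA
    have hB := (hall (((n - 1 : ℕ) : ZMod (2 * n)), 0)).1 ((natCast_zero_mem_iff hS (by omega)).2 (by omega))
    rw [Prod.mk_sub_mk, sub_zero, mk_zero_mem_iff hS, val_sub_natCast_eq u₁ (show n - 1 < 2 * n by omega)] at hB
    have hC := (hall (((n + 1 : ℕ) : ZMod (2 * n)), 1)).1 ((natCast_one_mem_iff hS (by omega)).2 (Or.inr rfl))
    rw [Prod.mk_sub_mk, show (0 : ZMod 2) - 1 = 1 by decide, mk_one_mem_iff hS,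
      val_sub_natCast_eq u₁ (show n + 1 < 2 * n by omega)] at hC
    split_ifs at hB hC <;> omega
  · -- axis `(u₁, 1)`: the rows are swapped
    have hA := (hall (((0 : ℕ) : ZMod (2 * n)), 1)).1
      ((natCast_one_mem_iff hS (by omega)).2 (Or.inl ⟨by omega, by omega⟩))
    rw [Prod.mk_sub_mk, Nat.cast_zero, sub_zero, sub_self, mk_zero_mem_iff hS] at hA
    have hB : ¬ ((u₁ - ((1 : ℕ) : ZMod (2 * n)), (1 : ZMod 2) - 1) ∈ S) := fun h =>
      absurd ((hall (((1 : ℕ) : ZMod (2 * n)), 1)).2 (by rwa [Prod.mk_sub_mk]))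
        (by rw [natCast_one_mem_iff hS (by omega)]; omega)
    rw [sub_self, mk_zero_mem_iff hS, val_sub_natCast_eq u₁ (show 1 < 2 * n by omega)] at hB
    have hC := (hall (((2 : ℕ) : ZMod (2 * n)), 1)).1
      ((natCast_one_mem_iff hS (by omega)).2 (Or.inl ⟨by omega, by omega⟩))
    rw [Prod.mk_sub_mk, sub_self, mk_zero_mem_iff hS, val_sub_natCast_eq u₁ (show 2 < 2 * n by omega)] at hC
    split_ifs at hB hC <;> omega

end Summit.HodgeConjecture.CorCM.CyclicAsymmetricHalvesTimesTwo
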